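import Mathlib
import Summits.KontsevichZagierPeriods.Zeta5Search.WedgeDictionaryGroupTransport
import Summits.KontsevichZagierPeriods.Zeta5Search.WedgeDictionaryDictStarWide
import Summits.KontsevichZagierPeriods.Zeta5Search.CellStarPencilDischarge
import HarnessLib

/-!
# `ExplicitPQAt` transports along every `σ ∈ Σ₇` between WIDE-region points (cell `pub-zeta5`, seat ct-1 g23)

HONEST FRAMING: systematic search; no irrationality claim unless certified.  Equivalences between displayed instances of gen-1's
dictionary statement `ExplicitPQAt a j` (`I(a) = Q(a)θ − 4P̂_d(a)ζ(2) − 2P_d(a)`) at two points of one `Σ₇`-orbit of Brown–Zudilin's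
parameter lattice (arXiv:2210.03391, Sect. 7, (27)); no integral is evaluated, nothing about `ζ(5)`; no `def`, no new node.

gen-1 g15's `explicitPQAt_transport` / ct-1 g17's `CellStarPencilDischarge.explicitPQAt_slotPerm` move `ExplicitPQAt` along the group
`G ≅ Σ₇` between HALF-BOX points (`RegionHyp` at both ends): the only half-box ingredient is the `Q`-identity `wedgeDictionary_Q`.  With
ct-1 g22's `WedgeDictionaryFullQ.wedgeDictionaryFull_Q` (`Q = ρ·(U∧W)` on the whole WIDE region `b ≥ 0`, `d ≥ 0`, every partner) the
same bookkeeping (`ρ = ρ_core·∏_F h!`, `ρ_core` and `U, W, V` are `Σ₇`-invariant, (27) = `invariance_group_holds`) gives: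

* the wide hypotheses are spelled out in each statement: `j ∈ [1,7]`, `Converges a`, `b(a)_i ≥ 0 (i ∈ [1,7])`, `d(b(a)) ≥ 0` (no `def`);
* `explicitPQAt_partner_wide` — on the wide region `ExplicitPQAt a j ↔ ExplicitPQAt a k` for all partners (`dict_values_wide`);
* `explicitPQAt_transport_wide` — the abstract transport with the wide hypotheses at both ends;
* `explicitPQAt_slotPerm_wide`, `explicitPQAt_slotPerm_wide_iff` — **for every `σ ∈ Σ₇`, a wide point `a` and its image `σ·a`
  (convergent): `ExplicitPQAt a j ↔ ExplicitPQAt (σ·a) j'`**, any partners `j, j' ∈ [1,7]`;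
* `wide_slotPerm` — the wide hypotheses themselves transport (`b(σ·a) = σ⁻¹ ∘ b(a)`, `d` invariant).

Use (successor map `HOME/ct-1/g22/WIDE-RESIDUAL.md` §5 / ct-1 g23 plan): the induction for the off-half-box residual of
`wedgeDictionaryFull` may normalise the slot arrangement of its target by `Σ₇` before applying a typed STAR / BRIDGE step.
-/

noncomputable section

open Finset

namespace Summit.KontsevichZagierPeriods.Zeta5Search.ExplicitPQWideTransport

open Summit.KontsevichZagierPeriods.Zeta5Search.WedgeDictionary
open Summit.KontsevichZagierPeriods.Zeta5Search.WedgeDictionaryDictStarWide (dict_values_wide)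
open Summit.KontsevichZagierPeriods.Zeta5Search.WedgeDictionaryFullQ (wedgeDictionaryFull_Q)
open Summit.KontsevichZagierPeriods.Zeta5Search.CellStarPencilDischarge (bOfA_slotPerm)
open Summit.KontsevichZagierPeriods.Zeta5Search.InvarianceGroup (invariance_group_holds)
open Summit.KontsevichZagierPeriods.Zeta5Search.SymmetricGauge (permLower permLower_apply_succ permLower_zero
  permLower_apply_of_not coeffU_permLower coeffV_permLower coeffW_permLower shift_permLower dOf_permLower
  sum_range7_permLower rhoB rhoOf_eq_rhoB)
open Summit.KontsevichZagierPeriods.Zeta5Search.CasoratianValuation (shift)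
open Literature.NumberTheory.Irrationality.BrownZudilin2022
open Literature.NumberTheory.Transcendental (zetaValue)

/-! ## 1. Partner independence on the wide region -/

/-- **Partner independence on the wide region**: for convergent `a` with `b(a) ≥ 0`, `d ≥ 0` and any two partners
`j, k ∈ [1,7]`, `ExplicitPQAt a j ↔ ExplicitPQAt a k` (both dictionary parts are `ρ·(U∧V)`, `ρ·(V∧W)` by `dict_values_wide`). [folklore] -/
theorem explicitPQAt_partner_wide {a : Fin 8 → ℤ} (hconv : Converges a) (hnn : ∀ i ∈ Icc 1 7, 0 ≤ bOfA a i)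
    (hd : 0 ≤ dOf (bOfA a)) {j k : ℕ} (hj : j ∈ Icc 1 7) (hk : k ∈ Icc 1 7) : ExplicitPQAt a j ↔ ExplicitPQAt a k := by
  obtain ⟨-, hPj, hj'⟩ := dict_values_wide hj hconv hnn hd
  obtain ⟨-, hPk, hk'⟩ := dict_values_wide hk hconv hnn hd
  unfold ExplicitPQAt
  rw [hPj, hPk, hj', hk']

/-! ## 2. The abstract transport with wide hypotheses -/

/-- **Transport of `ExplicitPQAt` along a group element, wide form.**  If `b(g a) = σ • b(a)`, the normalised integrals (27) agree
at `a` and `g a`, both points are convergent with non-negative dual slots and `d ≥ 0`, and the partners are `j = σ(i)+1` at `a`,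
`i+1` at `g a`, then `ExplicitPQAt a j → ExplicitPQAt (g a) (i+1)` — gen-1's `explicitPQAt_transport` with `wedgeDictionary_Q`
replaced by ct-1 g22's wide `wedgeDictionaryFull_Q`. [folklore] -/
theorem explicitPQAt_transport_wide {g : (Fin 8 → ℤ) → (Fin 8 → ℤ)} {σ : Equiv.Perm (Fin 7)} {a : Fin 8 → ℤ}
    (hb : bOfA (g a) = permLower σ (bOfA a)) (hI : normalisedIntegral' (g a) = normalisedIntegral' a)
    (i : Fin 7) {j : ℕ} (hj : j = (σ i).val + 1)
    (hjI : j ∈ Icc 1 7) (hconv : Converges a) (hnn : ∀ m ∈ Icc 1 7, 0 ≤ bOfA a m) (hd : 0 ≤ dOf (bOfA a))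
    (hconv' : Converges (g a)) (hnn' : ∀ m ∈ Icc 1 7, 0 ≤ bOfA (g a) m) (hd' : 0 ≤ dOf (bOfA (g a)))
    (h : ExplicitPQAt a j) : ExplicitPQAt (g a) (i.val + 1) := by
  have hjI' : i.val + 1 ∈ Icc 1 7 := by have := i.isLt; simp only [mem_Icc]; omega
  have hF1 : (0 : ℝ) < ((prodFNat (bOfA a) : ℕ) : ℝ) := by exact_mod_cast prodFNat_pos _
  have hF2 : (0 : ℝ) < ((prodFNat (bOfA (g a)) : ℕ) : ℝ) := by exact_mod_cast prodFNat_pos _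
  -- (27): `I(g a) · F(a) = I(a) · F(g a)`
  have hIa : cellularIntegral (g a) * ((prodFNat (bOfA a) : ℕ) : ℝ) =
      cellularIntegral a * ((prodFNat (bOfA (g a)) : ℕ) : ℝ) := by
    unfold normalisedIntegral' at hI
    rw [prodF_eq_cast, prodF_eq_cast, div_eq_div_iff hF2.ne' hF1.ne'] at hI
    exact hI
  -- covariance of the three dictionary components (in `ℚ`)
  have hQa := wedgeDictionaryFull_Q hconv hnn hd hjI
  have hQg := wedgeDictionaryFull_Q hconv' hnn' hd' hjI'
  have hQ : (QOf (g a) : ℚ) * (prodFNat (bOfA a) : ℚ) = (QOf a : ℚ) * (prodFNat (bOfA (g a)) : ℚ) := by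
    rw [hQg, hQa, rhoOf_eq_rhoB, rhoOf_eq_rhoB, update_eq_shift, update_eq_shift, hb, rhoB_eq_core, rhoB_eq_core,
      rhoCore_permLower, shift_permLower]
    simp only [coeffU_permLower, coeffW_permLower]
    rw [← hj]
    ring
  have hPh : dictPhat (g a) (i.val + 1) * (prodFNat (bOfA a) : ℚ) = dictPhat a j * (prodFNat (bOfA (g a)) : ℚ) := by
    unfold dictPhat
    rw [rhoOf_eq_rhoB, rhoOf_eq_rhoB, update_eq_shift, update_eq_shift, hb, rhoB_eq_core, rhoB_eq_core,
      rhoCore_permLower, shift_permLower]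
    simp only [coeffU_permLower, coeffV_permLower]
    rw [← hj]
    ring
  have hP : dictP (g a) (i.val + 1) * (prodFNat (bOfA a) : ℚ) = dictP a j * (prodFNat (bOfA (g a)) : ℚ) := by
    unfold dictP
    rw [rhoOf_eq_rhoB, rhoOf_eq_rhoB, update_eq_shift, update_eq_shift, hb, rhoB_eq_core, rhoB_eq_core,
      rhoCore_permLower, shift_permLower]
    simp only [coeffW_permLower, coeffV_permLower]
    rw [← hj]
    ring
  -- cast to `ℝ`
  have hQr : (QOf (g a) : ℝ) * ((prodFNat (bOfA a) : ℕ) : ℝ) = (QOf a : ℝ) * ((prodFNat (bOfA (g a)) : ℕ) : ℝ) := by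
    exact_mod_cast hQ
  have hPhr : (dictPhat (g a) (i.val + 1) : ℝ) * ((prodFNat (bOfA a) : ℕ) : ℝ) =
      (dictPhat a j : ℝ) * ((prodFNat (bOfA (g a)) : ℕ) : ℝ) := by
    exact_mod_cast hPh
  have hPr : (dictP (g a) (i.val + 1) : ℝ) * ((prodFNat (bOfA a) : ℕ) : ℝ) =
      (dictP a j : ℝ) * ((prodFNat (bOfA (g a)) : ℕ) : ℝ) := by
    exact_mod_cast hP
  unfold ExplicitPQAt at h ⊢
  refine mul_right_cancel₀ hF1.ne' ?_
  linear_combination hIa + ((prodFNat (bOfA (g a)) : ℕ) : ℝ) * h -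
    (2 * zetaValue 5 + 4 * zetaValue 3 * zetaValue 2) * hQr + 4 * zetaValue 2 * hPhr + 2 * hPr

/-! ## 3. Transport along every `σ ∈ Σ₇` between wide points -/

/-- The wide hypotheses transport along `σ`: `b(σ·a)` has non-negative slots and the same `d` as `b(a)`. [folklore] -/
theorem wide_slotPerm (σ : Equiv.Perm (Fin 7)) {a : Fin 8 → ℤ} (hnn : ∀ m ∈ Icc 1 7, 0 ≤ bOfA a m)
    (hd : 0 ≤ dOf (bOfA a)) :
    (∀ m ∈ Icc 1 7, 0 ≤ bOfA (slotPerm σ a) m) ∧ 0 ≤ dOf (bOfA (slotPerm σ a)) := by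
  refine ⟨fun m hm => ?_, by rw [bOfA_slotPerm, dOf_permLower]; exact hd⟩
  simp only [mem_Icc] at hm
  obtain ⟨k, rfl⟩ : ∃ k : Fin 7, m = k.val + 1 := ⟨⟨m - 1, by omega⟩, by simp only; omega⟩
  have hk := (σ⁻¹ k).isLt
  rw [bOfA_slotPerm, permLower_apply_succ]
  exact hnn _ (by simp only [mem_Icc]; omega)

/-- **`ExplicitPQAt` transports along every `σ ∈ Σ₇` between wide points**: for a convergent `a` with `b(a) ≥ 0`, `d ≥ 0`, and
`σ·a` convergent, `ExplicitPQAt a j → ExplicitPQAt (σ·a) j'` for any partners `j, j' ∈ [1,7]` ((27) by `invariance_group_holds`,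
`b(σ·a) = σ⁻¹ ∘ b(a)` by `bOfA_slotPerm`, then `explicitPQAt_transport_wide` and `explicitPQAt_partner_wide`). [folklore] -/
theorem explicitPQAt_slotPerm_wide (σ : Equiv.Perm (Fin 7)) {a : Fin 8 → ℤ} {j j' : ℕ} (hj : j ∈ Icc 1 7) (hj' : j' ∈ Icc 1 7)
    (hconv : Converges a) (hnn : ∀ m ∈ Icc 1 7, 0 ≤ bOfA a m) (hd : 0 ≤ dOf (bOfA a)) (hc : Converges (slotPerm σ a))
    (h : ExplicitPQAt a j) : ExplicitPQAt (slotPerm σ a) j' := by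
  have hjI := hj
  simp only [mem_Icc] at hjI
  obtain ⟨hnn', hd'⟩ := wide_slotPerm σ hnn hd
  set i₀ : Fin 7 := ⟨j - 1, by omega⟩ with hi₀
  have hσ : σ⁻¹ (σ i₀) = i₀ := σ.symm_apply_apply i₀
  have hje : j = (σ⁻¹ (σ i₀)).val + 1 := by
    rw [hσ]
    simp only [hi₀]
    omega
  have hi' : (σ i₀).val + 1 ∈ Icc 1 7 := by have := (σ i₀).isLt; simp only [mem_Icc]; omega
  have t := explicitPQAt_transport_wide (g := slotPerm σ) (σ := σ⁻¹) (bOfA_slotPerm σ a)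
    (invariance_group_holds σ a hconv hc) (σ i₀) hje hj hconv hnn hd hc hnn' hd' h
  exact (explicitPQAt_partner_wide hc hnn' hd' hi' hj').1 t

/-- **One point per `Σ₇`-orbit on the wide region**: `ExplicitPQAt a j ↔ ExplicitPQAt (σ·a) j'` whenever `a` is a convergent point
with `b(a) ≥ 0`, `d ≥ 0` and `σ·a` converges. [folklore] -/
theorem explicitPQAt_slotPerm_wide_iff (σ : Equiv.Perm (Fin 7)) {a : Fin 8 → ℤ} {j j' : ℕ} (hj : j ∈ Icc 1 7)
    (hj' : j' ∈ Icc 1 7) (hconv : Converges a) (hnn : ∀ m ∈ Icc 1 7, 0 ≤ bOfA a m) (hd : 0 ≤ dOf (bOfA a))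
    (hc : Converges (slotPerm σ a)) : ExplicitPQAt a j ↔ ExplicitPQAt (slotPerm σ a) j' := by
  refine ⟨explicitPQAt_slotPerm_wide σ hj hj' hconv hnn hd hc, fun h => ?_⟩
  obtain ⟨hnn', hd'⟩ := wide_slotPerm σ hnn hd
  have e : slotPerm σ⁻¹ (slotPerm σ a) = a := by
    rw [← AmpleGroupInvariance.slotPerm_mul, inv_mul_cancel, AmpleGroupInvariance.slotPerm_one]
  have t := explicitPQAt_slotPerm_wide σ⁻¹ hj' hj hc hnn' hd' (by rw [e]; exact hconv) h
  rw [e] at t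
  exact t

end Summit.KontsevichZagierPeriods.Zeta5Search.ExplicitPQWideTransport

end
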